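import Mathlib
import Literature.MathematicalPhysics.QuantumFieldTheory.ConstructiveQFTWave0OddRPProofs
import Literature.MathematicalPhysics.QuantumFieldTheory.LatticeGaugeProofs
import HarnessLib

/-!
# Hankel positivity of the plaquette-probe two-point function on the odd torus

Helper file for the support item `RPProbeCriticality` (route `EquipartitionCriticality` of
`YangMills`, item `stmt-QuantumFields-8763`): the reflection-positivity input of "device B".

On the odd torus `(ℤ/(2S+1)ℤ)⁴` Wave 0's time reflection `θ t = 1 - t`
(`GaugeConfig.timeReflect`) is a SITE reflection about the lattice hyperplane `t = S + 1`
(and a link reflection about `t = 1/2`); the tree's Osterwalder–Seiler theorem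
`wilsonExpectation_oddReflectionPositive` (Osterwalder–Seiler 1978 §2; Borgs–Seiler 1983 §II.2;
Fröhlich–Israel–Lieb–Simon 1978 Thm. 2.1) gives `⟨F∘Θ · F⟩ ≥ 0` for bounded measurable `F`
depending on the links of the closed half `1 ≤ t ≤ S + 1`.

For a family of *site observables* `q_x` (bounded measurable, `q_x` depending on the spatial
links of the time slice of `x`, carried along by torus translations and by `Θ`; the case in point
is the site probe `q_x(U) = ψ(U_{p₁₂(x)})`, `ψ : G → ℝ` continuous, `p₁₂(x)` the spatial
plaquette at `x` in the `(1,2)` plane) we take `F = a (q_{x_i} - q̄) + b (q_{x_j} - q̄)` with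
`x_i = (S+1-i) e₀`, `x_j = (S+1-j) e₀` (`0 ≤ i, j ≤ S`), use `q_x ∘ Θ = q_{θx}`, translation
invariance of the torus Wilson state (`wilsonMeasure_map_torusConfigShift`) and
`2(S+1) ≡ 1 (mod 2S+1)` to obtain the `2 × 2` Hankel positivity of the connected two-point
function `κ(n) = ⟨q₀ q_{n e₀}⟩ - ⟨q₀⟩²` along the time axis:

  `0 ≤ a² κ(2i) + 2ab κ(i+j) + b² κ(2j)`  (`torus_hankel_nonneg_of`, `torus_hankel_nonneg`).

No definitions are introduced (observables are explicit lambdas / hypotheses).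

References: K. Osterwalder, E. Seiler, Ann. Phys. 110 (1978) 440, §2; C. Borgs, E. Seiler,
Commun. Math. Phys. 91 (1983) 329, §II.2; J. Glimm, A. Jaffe, *Quantum Physics* (1987) §6.1;
E. Seiler, LNP 159 (1982) Ch. 2.
-/

noncomputable section

open MeasureTheory ProbabilityTheory
open Literature.MathematicalPhysics.QuantumFieldTheory

namespace Summit.QuantumFields.YangMills.Theorems.EquipartitionCriticality.RPProbe

variable {G : Type*} [Group G]

/-! ### Geometry of the time axis of `(ℤ/Lℤ)⁴` -/

section Geometry

variable {L : ℕ}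

/-- **Spatial plaquettes are carried along by the time reflection**: for spatial directions
`i, j ≠ 0`, the `(i, j)` plaquette holonomy of `ΘU` at `x` is the `(i, j)` plaquette holonomy
of `U` at `θx` (`θ t = 1 - t`; Osterwalder–Seiler 1978 §2). [folklore] -/
theorem plaquetteHolonomy_timeReflect_spatial (U : GaugeConfig 4 L G) (x : Site 4 L)
    {i j : Fin 4} (hi : i ≠ 0) (hj : j ≠ 0) :
    plaquetteHolonomy (GaugeConfig.timeReflect U) x i j =
      plaquetteHolonomy U (Site.timeReflect x) i j := by
  simp only [plaquetteHolonomy, GaugeConfig.timeReflect, hi, hj, if_false,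
    WilsonRP.timeReflect_shift_of_ne _ hi, WilsonRP.timeReflect_shift_of_ne _ hj]

/-- The reflection `θ t = 1 - t` on the time axis: `θ (c e₀) = (1 - c) e₀`. [folklore] -/
theorem timeReflect_single_zero (c : ZMod L) :
    Site.timeReflect (Pi.single (0 : Fin 4) c : Site 4 L) =
      (Pi.single (0 : Fin 4) (1 - c) : Site 4 L) := by
  funext k
  by_cases hk : k = 0
  · subst hk
    simp [Site.timeReflect]
  · simp [Site.timeReflect, hk]

/-- A site probe `U ↦ ψ(U_{p₁₂(x)})` depends only on the spatial links in the time slice of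
`x`. [folklore] -/
theorem dependsOn_siteProbe (ψ : G → ℝ) (x : Site 4 L) :
    DependsOn (fun U : GaugeConfig 4 L G => ψ (plaquetteHolonomy U x 1 2))
      {e : Edge 4 L | e.1 0 = x 0 ∧ e.2 ≠ 0} := by
  intro U V hUV
  have h1 : (1 : Fin 4) ≠ 0 := by decide
  have h2 : (2 : Fin 4) ≠ 0 := by decide
  simp only [plaquetteHolonomy]
  rw [hUV (x, 1) ⟨rfl, h1⟩, hUV (x, 2) ⟨rfl, h2⟩,
    hUV (x.shift 1, 2) ⟨WilsonRP.shift_apply_of_ne x h1.symm, h2⟩,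
    hUV (x.shift 2, 1) ⟨WilsonRP.shift_apply_of_ne x h2.symm, h1⟩]

end Geometry

/-! ### The torus Wilson state: reflection positivity and translation invariance -/

section Torus

variable [TopologicalSpace G] [IsTopologicalGroup G] [CompactSpace G] [MeasurableSpace G]
  [BorelSpace G] {N : ℕ} (ρ : G →* Matrix (Fin N) (Fin N) ℂ)

/-- **Reflection positivity on the odd torus, real form** (the real reading of the tree's complex
statement `wilsonExpectation_oddReflectionPositive`; Osterwalder–Seiler 1978 §2, Borgs–Seiler
1983 §II.2): on the torus of side `2S+1`, `S ≥ 1`, at `β ≥ 0`, `0 ≤ ∫ F(ΘU) F(U) dμ_β` for every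
bounded measurable real `F` depending only on the links of the closed positive half (links based
in `1 ≤ t ≤ S`, spatial links of the slice `t = S + 1`). [folklore] -/
theorem integral_timeReflect_mul_self_nonneg (hρ : Continuous ρ) {β : ℝ} (hβ : 0 ≤ β) {S : ℕ}
    (hS : 1 ≤ S) (F : GaugeConfig 4 (2 * S + 1) G → ℝ) (hF : Measurable F)
    (hFb : ∃ C : ℝ, ∀ U, |F U| ≤ C)
    (hFdep : DependsOn F {e : Edge 4 (2 * S + 1) |
      WilsonOddRP.IsOPosEdge e ∨ WilsonOddRP.IsOSharedEdge e}) :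
    0 ≤ ∫ U, F (GaugeConfig.timeReflect U) * F U
      ∂(wilsonMeasure (d := 4) (L := 2 * S + 1) ρ β) := by
  obtain ⟨C, hC⟩ := hFb
  have hdep' : DependsOn F ((WilsonOddRP.oPosEdges ∪ WilsonOddRP.oSharedEdges :
      Finset (Edge 4 (2 * S + 1))) : Set (Edge 4 (2 * S + 1))) := fun U V hUV =>
    hFdep fun e he => hUV e (by
      simpa only [Finset.coe_union, Set.mem_union, Finset.mem_coe, WilsonOddRP.mem_oPosEdges,
        WilsonOddRP.mem_oSharedEdges, Set.mem_setOf_eq] using he)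
  have h := wilsonExpectation_oddReflectionPositive (d := 4) (L := 2 * S + 1) ρ ⟨S, by ring⟩
    (by omega) hρ hβ (fun U => ((F U : ℝ) : ℂ)) (Complex.measurable_ofReal.comp hF)
    ⟨C, fun U => by simpa [Complex.norm_real, Real.norm_eq_abs] using hC U⟩
    (fun U V hUV => by simp only [hdep' hUV])
  have hre : (wilsonExpectation ρ β fun U : GaugeConfig 4 (2 * S + 1) G =>
      (starRingEnd ℂ) ((F U.timeReflect : ℝ) : ℂ) * ((F U : ℝ) : ℂ)) =
      ((∫ U, F (GaugeConfig.timeReflect U) * F U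
          ∂(wilsonMeasure (d := 4) (L := 2 * S + 1) ρ β) : ℝ) : ℂ) := by
    simp only [wilsonExpectation, Complex.conj_ofReal, ← Complex.ofReal_mul]
    exact integral_ofReal
  rw [hre] at h
  exact Complex.zero_le_real.1 h

variable {L : ℕ} [NeZero L]

/-- **Translation invariance of one-point functions** of a translation-covariant family of site
observables (`q_x ∘ τ_v = q_{x - v}`) under the torus Wilson state
(`wilsonMeasure_map_torusConfigShift`). [folklore] -/
theorem integral_site_eq_of_shift (β : ℝ) {q : Site 4 L → GaugeConfig 4 L G → ℝ}
    (hshift : ∀ v x U, q x (torusConfigShift v U) = q (x - v) U) (x : Site 4 L) :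
    ∫ U, q x U ∂(wilsonMeasure (d := 4) (L := L) ρ β) =
      ∫ U, q 0 U ∂(wilsonMeasure (d := 4) (L := L) ρ β) := by
  have h := wilsonExpectation_comp_torusConfigShift (d := 4) ρ β (-x) (q 0)
  simp only [wilsonExpectation, Function.comp_apply, hshift, zero_sub, neg_neg] at h
  exact h

/-- **Translation invariance of covariances** of a translation-covariant family of site
observables under the torus Wilson state: `Cov(q_y, q_z) = Cov(q_0, q_{z-y})`
(`covariance_map_equiv` and `wilsonMeasure_map_torusConfigShift`). [folklore] -/
theorem covariance_site_eq_of_shift (β : ℝ) {q : Site 4 L → GaugeConfig 4 L G → ℝ}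
    (hshift : ∀ v x U, q x (torusConfigShift v U) = q (x - v) U) (y z : Site 4 L) :
    cov[q y, q z; wilsonMeasure (d := 4) (L := L) ρ β] =
      cov[q 0, q (z - y); wilsonMeasure (d := 4) (L := L) ρ β] := by
  conv_rhs => rw [← wilsonMeasure_map_torusConfigShift ρ β (-y), covariance_map_equiv]
  have h0 : (0 : Site 4 L) - -y = y := by simp
  have h1 : z - y - -y = z := by simp
  simp only [Function.comp_def, hshift, h0, h1]

/-- **Symmetry of the time-axis covariance**: `Cov(q_0, q_{-v}) = Cov(q_0, q_v)` for a
translation-covariant family (translation by `v` and symmetry of the covariance). [folklore] -/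
theorem covariance_site_neg_of_shift (β : ℝ) {q : Site 4 L → GaugeConfig 4 L G → ℝ}
    (hshift : ∀ v x U, q x (torusConfigShift v U) = q (x - v) U) (v : Site 4 L) :
    cov[q 0, q (-v); wilsonMeasure (d := 4) (L := L) ρ β] =
      cov[q 0, q v; wilsonMeasure (d := 4) (L := L) ρ β] := by
  have h := covariance_site_eq_of_shift ρ β hshift v 0
  rw [zero_sub] at h
  rw [← h, covariance_comm]

/-! ### The `2 × 2` Hankel positivity -/

/-- **Hankel positivity on the odd torus for a covariant family of slice observables.** Let
`q_x` (`x` a site of `(ℤ/(2S+1)ℤ)⁴`, `S ≥ 1`) be bounded measurable real observables with `q_x`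
depending only on the spatial links of the time slice of `x`, `q_x ∘ τ_v = q_{x-v}` for torus
translations and `q_x ∘ Θ = q_{θx}` for the time reflection `θ t = 1 - t`. Then at `β ≥ 0`,
for continuous `ρ`, the connected time-axis two-point function
`κ(n) = ⟨q₀ q_{n e₀}⟩_β - ⟨q₀⟩_β²` satisfies `0 ≤ a² κ(2i) + 2ab κ(i+j) + b² κ(2j)` for all
`0 ≤ i, j ≤ S`, real `a, b`. Proof: reflection positivity (`integral_timeReflect_mul_self_nonneg`)
for `F = a (q_{(S+1-i)e₀} - q̄) + b (q_{(S+1-j)e₀} - q̄)`, which lives on the closed positive half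
of the site reflection about `t = S + 1`; covariance, translation invariance and
`(S+1-i) + (S+1-j) - 1 ≡ -(i+j) (mod 2S+1)` turn `⟨F∘Θ · F⟩` into the displayed form
(Osterwalder–Seiler 1978 §2; Glimm–Jaffe 1987 §6.1). [folklore] -/
theorem torus_hankel_nonneg_of (hρ : Continuous ρ) {β : ℝ} (hβ : 0 ≤ β) {S : ℕ} (hS : 1 ≤ S)
    {q : Site 4 (2 * S + 1) → GaugeConfig 4 (2 * S + 1) G → ℝ} (hqm : ∀ x, Measurable (q x))
    {Cq : ℝ} (hqb : ∀ x U, |q x U| ≤ Cq)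
    (hdep : ∀ x, DependsOn (q x) {e : Edge 4 (2 * S + 1) | e.1 0 = x 0 ∧ e.2 ≠ 0})
    (hshift : ∀ v x U, q x (torusConfigShift v U) = q (x - v) U)
    (hθ : ∀ x U, q x (GaugeConfig.timeReflect U) = q (Site.timeReflect x) U)
    {i j : ℕ} (hi : i ≤ S) (hj : j ≤ S) (a b : ℝ) :
    0 ≤ a ^ 2 * ((∫ U, q 0 U * q (Pi.single 0 ((2 * i : ℕ) : ZMod (2 * S + 1))) U
            ∂(wilsonMeasure (d := 4) (L := 2 * S + 1) ρ β)) -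
          (∫ U, q 0 U ∂(wilsonMeasure (d := 4) (L := 2 * S + 1) ρ β)) *
            (∫ U, q 0 U ∂(wilsonMeasure (d := 4) (L := 2 * S + 1) ρ β))) +
      2 * a * b * ((∫ U, q 0 U * q (Pi.single 0 ((i + j : ℕ) : ZMod (2 * S + 1))) U
            ∂(wilsonMeasure (d := 4) (L := 2 * S + 1) ρ β)) -
          (∫ U, q 0 U ∂(wilsonMeasure (d := 4) (L := 2 * S + 1) ρ β)) *
            (∫ U, q 0 U ∂(wilsonMeasure (d := 4) (L := 2 * S + 1) ρ β))) +
      b ^ 2 * ((∫ U, q 0 U * q (Pi.single 0 ((2 * j : ℕ) : ZMod (2 * S + 1))) U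
            ∂(wilsonMeasure (d := 4) (L := 2 * S + 1) ρ β)) -
          (∫ U, q 0 U ∂(wilsonMeasure (d := 4) (L := 2 * S + 1) ρ β)) *
            (∫ U, q 0 U ∂(wilsonMeasure (d := 4) (L := 2 * S + 1) ρ β))) := by
  haveI : IsProbabilityMeasure (wilsonMeasure (d := 4) (L := 2 * S + 1) ρ β) :=
    isProbabilityMeasure_wilsonMeasure ρ hρ β
  have hLp : ∀ x, MemLp (q x) 2 (wilsonMeasure (d := 4) (L := 2 * S + 1) ρ β) := fun x =>
    MemLp.of_bound (hqm x).aestronglyMeasurable Cq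
      (ae_of_all _ fun U => by simpa [Real.norm_eq_abs] using hqb x U)
  set qbar : ℝ := ∫ U, q 0 U ∂(wilsonMeasure (d := 4) (L := 2 * S + 1) ρ β) with hqbar
  have hmean : ∀ x, ∫ U, q x U ∂(wilsonMeasure (d := 4) (L := 2 * S + 1) ρ β) = qbar :=
    fun x => integral_site_eq_of_shift ρ β hshift x
  -- covariances along the time axis
  have hcov : ∀ x : Site 4 (2 * S + 1),
      cov[q 0, q x; wilsonMeasure (d := 4) (L := 2 * S + 1) ρ β] =
        (∫ U, q 0 U * q x U ∂(wilsonMeasure (d := 4) (L := 2 * S + 1) ρ β)) - qbar * qbar := by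
    intro x
    rw [covariance_eq_sub (hLp _) (hLp _), hmean, hmean]
    rfl
  -- the centred two-point function as a covariance
  have hT : ∀ y z : Site 4 (2 * S + 1),
      ∫ U, (q y U - qbar) * (q z U - qbar) ∂(wilsonMeasure (d := 4) (L := 2 * S + 1) ρ β) =
        cov[q 0, q (z - y); wilsonMeasure (d := 4) (L := 2 * S + 1) ρ β] := by
    intro y z
    rw [← covariance_site_eq_of_shift ρ β hshift y z, covariance, hmean, hmean]
  have hTint : ∀ y z : Site 4 (2 * S + 1),
      Integrable (fun U => (q y U - qbar) * (q z U - qbar))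
        (wilsonMeasure (d := 4) (L := 2 * S + 1) ρ β) := fun y z =>
    ((hLp y).sub (memLp_const qbar)).integrable_mul ((hLp z).sub (memLp_const qbar))
  -- the two sites and their reflections
  set c₁ : ZMod (2 * S + 1) := ((S + 1 - i : ℕ) : ZMod (2 * S + 1)) with hc₁
  set c₂ : ZMod (2 * S + 1) := ((S + 1 - j : ℕ) : ZMod (2 * S + 1)) with hc₂
  set x₁ : Site 4 (2 * S + 1) := Pi.single 0 c₁ with hx₁
  set x₂ : Site 4 (2 * S + 1) := Pi.single 0 c₂ with hx₂
  have hL0 : (2 : ZMod (2 * S + 1)) * (S : ZMod (2 * S + 1)) + 1 = 0 := by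
    have h := ZMod.natCast_self (2 * S + 1)
    push_cast at h
    exact h
  have hc₁' : c₁ = (S : ZMod (2 * S + 1)) + 1 - i := by
    rw [hc₁, Nat.cast_sub (by omega)]; push_cast; ring
  have hc₂' : c₂ = (S : ZMod (2 * S + 1)) + 1 - j := by
    rw [hc₂, Nat.cast_sub (by omega)]; push_cast; ring
  -- the test observable
  set F : GaugeConfig 4 (2 * S + 1) G → ℝ := fun U => a * (q x₁ U - qbar) + b * (q x₂ U - qbar)
    with hF
  have hFm : Measurable F :=
    ((measurable_const.mul ((hqm x₁).sub measurable_const)).add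
      (measurable_const.mul ((hqm x₂).sub measurable_const)))
  have hFb : ∃ C : ℝ, ∀ U, |F U| ≤ C := by
    refine ⟨|a| * (Cq + |qbar|) + |b| * (Cq + |qbar|), fun U => ?_⟩
    have h1 : |q x₁ U - qbar| ≤ Cq + |qbar| := (abs_sub _ _).trans (add_le_add (hqb _ _) le_rfl)
    have h2 : |q x₂ U - qbar| ≤ Cq + |qbar| := (abs_sub _ _).trans (add_le_add (hqb _ _) le_rfl)
    calc |F U| ≤ |a * (q x₁ U - qbar)| + |b * (q x₂ U - qbar)| := abs_add_le _ _
      _ = |a| * |q x₁ U - qbar| + |b| * |q x₂ U - qbar| := by rw [abs_mul, abs_mul]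
      _ ≤ |a| * (Cq + |qbar|) + |b| * (Cq + |qbar|) :=
        add_le_add (mul_le_mul_of_nonneg_left h1 (abs_nonneg _))
          (mul_le_mul_of_nonneg_left h2 (abs_nonneg _))
  -- `F` lives on the closed positive half of the site reflection about `t = S + 1`
  have hval : ∀ {k : ℕ}, k ≤ S → ((S + 1 - k : ℕ) : ZMod (2 * S + 1)).val = S + 1 - k :=
    fun hk => ZMod.val_natCast_of_lt (by omega)
  have hslice : ∀ {k : ℕ}, k ≤ S → ∀ e : Edge 4 (2 * S + 1),
      e.1 0 = ((S + 1 - k : ℕ) : ZMod (2 * S + 1)) ∧ e.2 ≠ 0 →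
        WilsonOddRP.IsOPosEdge e ∨ WilsonOddRP.IsOSharedEdge e := by
    intro k hk e he
    have hv : (e.1 0).val = S + 1 - k := by rw [he.1, hval hk]
    by_cases hk0 : k = 0
    · right
      refine ⟨he.2, ?_⟩
      rw [hv]
      omega
    · left
      refine ⟨?_, ?_⟩ <;> rw [hv] <;> omega
  have hFdep : DependsOn F {e : Edge 4 (2 * S + 1) |
      WilsonOddRP.IsOPosEdge e ∨ WilsonOddRP.IsOSharedEdge e} := by
    intro U V hUV
    have e1 : q x₁ U = q x₁ V := hdep x₁ fun e he =>
      hUV e (hslice hi e (by simpa [hx₁] using he))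
    have e2 : q x₂ U = q x₂ V := hdep x₂ fun e he =>
      hUV e (hslice hj e (by simpa [hx₂] using he))
    simp only [hF, e1, e2]
  -- reflection positivity
  have hRP : 0 ≤ ∫ U, F (GaugeConfig.timeReflect U) * F U
      ∂(wilsonMeasure (d := 4) (L := 2 * S + 1) ρ β) :=
    integral_timeReflect_mul_self_nonneg ρ hρ hβ hS F hFm hFb hFdep
  -- the reflected observable
  have hFθ : ∀ U, F (GaugeConfig.timeReflect U) =
      a * (q (Pi.single 0 (1 - c₁)) U - qbar) + b * (q (Pi.single 0 (1 - c₂)) U - qbar) := by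
    intro U
    simp only [hF, hθ, hx₁, hx₂, timeReflect_single_zero]
  -- expand `∫ F∘Θ · F`
  have hexp : ∫ U, F (GaugeConfig.timeReflect U) * F U
      ∂(wilsonMeasure (d := 4) (L := 2 * S + 1) ρ β) =
      a ^ 2 * cov[q 0, q (x₁ - Pi.single 0 (1 - c₁)); wilsonMeasure (d := 4) (L := 2 * S + 1) ρ β] +
        a * b * cov[q 0, q (x₂ - Pi.single 0 (1 - c₁)); wilsonMeasure (d := 4) (L := 2 * S + 1) ρ β] +
        a * b * cov[q 0, q (x₁ - Pi.single 0 (1 - c₂)); wilsonMeasure (d := 4) (L := 2 * S + 1) ρ β] +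
        b ^ 2 * cov[q 0, q (x₂ - Pi.single 0 (1 - c₂)); wilsonMeasure (d := 4) (L := 2 * S + 1) ρ β] := by
    rw [← hT, ← hT, ← hT, ← hT]
    have hpt : ∀ U, F (GaugeConfig.timeReflect U) * F U =
        a ^ 2 * ((q (Pi.single 0 (1 - c₁)) U - qbar) * (q x₁ U - qbar)) +
          a * b * ((q (Pi.single 0 (1 - c₁)) U - qbar) * (q x₂ U - qbar)) +
          a * b * ((q (Pi.single 0 (1 - c₂)) U - qbar) * (q x₁ U - qbar)) +
          b ^ 2 * ((q (Pi.single 0 (1 - c₂)) U - qbar) * (q x₂ U - qbar)) := by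
      intro U
      rw [hFθ]
      simp only [hF]
      ring
    simp_rw [hpt]
    rw [integral_add, integral_add, integral_add, integral_const_mul, integral_const_mul,
      integral_const_mul, integral_const_mul]
    · exact (hTint _ _).const_mul _
    · exact (hTint _ _).const_mul _
    · exact ((hTint _ _).const_mul _).add ((hTint _ _).const_mul _)
    · exact (hTint _ _).const_mul _
    · exact (((hTint _ _).const_mul _).add ((hTint _ _).const_mul _)).add
        ((hTint _ _).const_mul _)
    · exact (hTint _ _).const_mul _
  -- site arithmetic on the time axis
  have hd₁₁ : x₁ - Pi.single 0 (1 - c₁) =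
      -(Pi.single (0 : Fin 4) (((2 * i : ℕ) : ZMod (2 * S + 1))) : Site 4 (2 * S + 1)) := by
    rw [hx₁, ← Pi.single_sub, ← Pi.single_neg]
    congr 1
    rw [hc₁']
    push_cast
    linear_combination hL0
  have hd₂₁ : x₂ - Pi.single 0 (1 - c₁) =
      -(Pi.single (0 : Fin 4) (((i + j : ℕ) : ZMod (2 * S + 1))) : Site 4 (2 * S + 1)) := by
    rw [hx₂, ← Pi.single_sub, ← Pi.single_neg]
    congr 1
    rw [hc₁', hc₂']
    push_cast
    linear_combination hL0
  have hd₁₂ : x₁ - Pi.single 0 (1 - c₂) =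
      -(Pi.single (0 : Fin 4) (((i + j : ℕ) : ZMod (2 * S + 1))) : Site 4 (2 * S + 1)) := by
    rw [hx₁, ← Pi.single_sub, ← Pi.single_neg]
    congr 1
    rw [hc₁', hc₂']
    push_cast
    linear_combination hL0
  have hd₂₂ : x₂ - Pi.single 0 (1 - c₂) =
      -(Pi.single (0 : Fin 4) (((2 * j : ℕ) : ZMod (2 * S + 1))) : Site 4 (2 * S + 1)) := by
    rw [hx₂, ← Pi.single_sub, ← Pi.single_neg]
    congr 1
    rw [hc₂']
    push_cast
    linear_combination hL0
  rw [hexp, hd₁₁, hd₂₁, hd₁₂, hd₂₂, covariance_site_neg_of_shift ρ β hshift,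
    covariance_site_neg_of_shift ρ β hshift, covariance_site_neg_of_shift ρ β hshift,
    hcov, hcov, hcov] at hRP
  linarith [hRP]

/-- **Hankel positivity of the plaquette-probe two-point function on the odd torus.** For
`S ≥ 1`, `β ≥ 0`, continuous `ρ`, a continuous bounded `ψ : G → ℝ`, the site probe
`q_x(U) = ψ(U_{p₁₂(x)})` (spatial plaquette at `x` in the `(1,2)` plane) and its connected
time-axis two-point function `κ(n) = ⟨q₀ q_{n e₀}⟩_β - ⟨q₀⟩_β²` under the Wilson state of the
torus `(ℤ/(2S+1)ℤ)⁴`: `0 ≤ a² κ(2i) + 2ab κ(i+j) + b² κ(2j)` for all `0 ≤ i, j ≤ S` and real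
`a, b` (`torus_hankel_nonneg_of` for this family; Osterwalder–Seiler 1978 §2, Glimm–Jaffe 1987
§6.1). [folklore] -/
theorem torus_hankel_nonneg [SecondCountableTopology G] (hρ : Continuous ρ) {β : ℝ} (hβ : 0 ≤ β)
    {ψ : G → ℝ} (hψ : Continuous ψ) (hψb : ∃ C : ℝ, ∀ g, |ψ g| ≤ C) {S : ℕ} (hS : 1 ≤ S)
    {i j : ℕ} (hi : i ≤ S) (hj : j ≤ S) (a b : ℝ) :
    0 ≤ a ^ 2 * ((∫ U, ψ (plaquetteHolonomy U 0 1 2) *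
            ψ (plaquetteHolonomy U (Pi.single 0 ((2 * i : ℕ) : ZMod (2 * S + 1))) 1 2)
            ∂(wilsonMeasure (d := 4) (L := 2 * S + 1) ρ β)) -
          (∫ U, ψ (plaquetteHolonomy U 0 1 2) ∂(wilsonMeasure (d := 4) (L := 2 * S + 1) ρ β)) *
            (∫ U, ψ (plaquetteHolonomy U 0 1 2) ∂(wilsonMeasure (d := 4) (L := 2 * S + 1) ρ β))) +
      2 * a * b * ((∫ U, ψ (plaquetteHolonomy U 0 1 2) *
            ψ (plaquetteHolonomy U (Pi.single 0 ((i + j : ℕ) : ZMod (2 * S + 1))) 1 2)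
            ∂(wilsonMeasure (d := 4) (L := 2 * S + 1) ρ β)) -
          (∫ U, ψ (plaquetteHolonomy U 0 1 2) ∂(wilsonMeasure (d := 4) (L := 2 * S + 1) ρ β)) *
            (∫ U, ψ (plaquetteHolonomy U 0 1 2) ∂(wilsonMeasure (d := 4) (L := 2 * S + 1) ρ β))) +
      b ^ 2 * ((∫ U, ψ (plaquetteHolonomy U 0 1 2) *
            ψ (plaquetteHolonomy U (Pi.single 0 ((2 * j : ℕ) : ZMod (2 * S + 1))) 1 2)
            ∂(wilsonMeasure (d := 4) (L := 2 * S + 1) ρ β)) -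
          (∫ U, ψ (plaquetteHolonomy U 0 1 2) ∂(wilsonMeasure (d := 4) (L := 2 * S + 1) ρ β)) *
            (∫ U, ψ (plaquetteHolonomy U 0 1 2) ∂(wilsonMeasure (d := 4) (L := 2 * S + 1) ρ β))) := by
  obtain ⟨C, hC⟩ := hψb
  have h10 : (1 : Fin 4) ≠ 0 := by decide
  have h20 : (2 : Fin 4) ≠ 0 := by decide
  exact torus_hankel_nonneg_of ρ hρ hβ hS (q := fun x U => ψ (plaquetteHolonomy U x 1 2))
    (fun x => hψ.measurable.comp (measurable_plaquetteHolonomy x 1 2)) (fun x U => hC _)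
    (fun x => dependsOn_siteProbe ψ x)
    (fun v x U => by simp only [plaquetteHolonomy_torusConfigShift])
    (fun x U => by simp only [plaquetteHolonomy_timeReflect_spatial U x h10 h20]) hi hj a b

end Torus

end Summit.QuantumFields.YangMills.Theorems.EquipartitionCriticality.RPProbe

end
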